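import Mathlib
import HarnessLib
import Summits.AtomisticToContinuum.Statement
import Literature.Geometry.DiscreteGeometry.KissingPatterns
import Literature.Probability.Process.PointStationaryLaw
import Literature.MathematicalPhysics.StatisticalMechanics.RootEnergy
import Literature.MathematicalPhysics.StatisticalMechanics.Crystallization
import Literature.MathematicalPhysics.StatisticalMechanics.MuGroundStateConfiguration
import Literature.MathematicalPhysics.StatisticalMechanics.BarlowStacking
import Literature.MathematicalPhysics.StatisticalMechanics.HaggStacking
import Summits.AtomisticToContinuum.Crystallization.Theorems.GrainCoreNetworkSplitDiluteRung

/-!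
# RepetitiveNetworkReduction — dilute rung (BC5 witness of weakness), decomp-a2c lens 2, g16

Supports the residual `GrainCoreNetworkSplit.DenseNetworkLawGap` (stmt-AtomisticToContinuum-27070) through its child node
RepetitiveNetworkReduction (Birkhoff–evaporation transfer + repetitive residual): the deterministic core
`stub_repetitiveRigidity` of the child's declared residual `RepetitiveNetworkLawGap` says that NO rooted δ-separated textured
Nash non-periodic grain-free core-free UNIFORMLY RECURRENT point set is an `e⋆`-μGSC of `V_LJ`.  This file proves it in the
dilute window `δ ≥ 4` — EXACT binder shape of the registered stub with `0 < δ` replaced by `4 ≤ δ` — by the removal test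
with empty replacement (the root is evaporable: its one-body energy is ≥ −(250/6)·4⁻⁶ > −1/24 ≥ e⋆), i.e. by the energy
half of the node's lever (evaporation) in its crudest regime.  Outside S's known regime in the sense the tribunal uses for
this lineage (same window as the parent's accepted witness `GrainCoreNetworkSplitDiluteRung.networkRigidity_rung_dilute`,
p794487): Crystallization is not known for any hard-core window, and the statement is about aperiodic recurrent networks,
on which nothing is in print.
-/

namespace Summit.AtomisticToContinuum.Crystallization.Theorems.RepetitiveNetworkReductionDiluteRung

open Literature.MathematicalPhysics.StatisticalMechanics
open Summit.AtomisticToContinuum.Crystallization.Theorems.GrainCoreNetworkSplitDiluteRung (not_isMuGSC_eStar_of_four_le)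

/-- **DILUTE ∀ δ : ℝ, 4 ≤ δ → ∀ S : Set (EuclideanSpace ℝ (Fin 3)), let Gy : ℝ → (N : ℕ) → (Fin N → EuclideanSpace ℝ (Fin 3)) → Fin N → Prop := fun η N y j => let d : ℝ := sInf ((fun z => dist z (y (j : Fin N))) '' (Set.range (y) \ {(y (j : Fin N))})); let T : Set (EuclideanSpace ℝ (Fin 3)) := {z : EuclideanSpace ℝ (Fin 3) | z ∈ Set.range (y) ∧ z ≠ (y (j : Fin N)) ∧ dist z (y (j : Fin N)) < 13 / 10 * d}; ∃ A : EuclideanSpace ℝ (Fin 3) →ₗᵢ[ℝ] EuclideanSpace ℝ (Fin 3), (∃ e : ↥T ≃ ↥Literature.Geometry.DiscreteGeometry.fccKissingPattern, ∀ t : ↥T, dist (d⁻¹ • ((t : EuclideanSpace ℝ (Fin 3)) - (y (j : Fin N)))) (A ((e t : ↥Literature.Geometry.DiscreteGeometry.fccKissingPattern) : EuclideanSpace ℝ (Fin 3))) ≤ η) ∨ (∃ e : ↥T ≃ ↥Literature.Geometry.DiscreteGeometry.hcpKissingPattern, ∀ t : ↥T, dist (d⁻¹ • ((t : EuclideanSpace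 ℝ (Fin 3)) - (y (j : Fin N)))) (A ((e t : ↥Literature.Geometry.DiscreteGeometry.hcpKissingPattern) : EuclideanSpace ℝ (Fin 3))) ≤ η); let TexBall : (N : ℕ) → (Fin N → EuclideanSpace ℝ (Fin 3)) → Fin N → ℝ → ℝ → ℝ → ℝ → Prop := fun N y i R R₇ R₈ R₉ => (∀ a b : Fin N, a ≠ b → (7 : ℝ) / 10 ≤ dist (y a) (y b)) ∧ (∀ j : Fin N, dist (y j) (y i) ≤ R → ¬ Gy (1 / 20) N (y) j) ∧ (∀ j : Fin N, dist (y j) (y i) ≤ R → ¬ ((∀ j' : Fin N, dist (y j') (y j) ≤ R₇ → ¬ Gy (1 / 20) N (y) j') ∧ (∀ z : EuclideanSpace ℝ (Fin 3), dist z (y j) ≤ R₇ → ∃ k : Fin N, dist z (y k) ≤ 1) ∧ (∀ j' : Fin N, dist (y j') (y j) ≤ R₇ → (let d : ℝ := sInf ((fun z => dist z (y j')) '' (Set.range (y) \ {(y j')})); ∀ k : Fin N, y k ≠ y j' → dist (y k) (y j') < 27 / 20 * d → 5 ≤ Nat.card {m : Fin N // y m ≠ y j' ∧ dist (y m) (y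 j') < 27 / 20 * d ∧ y m ≠ y k ∧ dist (y m) (y k) < 27 / 20 * d})))) ∧ (∀ j : Fin N, dist (y j) (y i) ≤ R → ∃ k : Fin N, dist (y k) (y j) ≤ R₈ ∧ Gy (1 / 8) N (y) k) ∧ (∀ j : Fin N, dist (y j) (y i) ≤ R → ¬ ((∀ j' : Fin N, dist (y j') (y j) ≤ R₉ → ¬ Gy (1 / 20) N (y) j') ∧ (Nat.card {j' : Fin N // dist (y j') (y j) ≤ R₉ ∧ ¬ Gy (1 / 8) N (y) j'} : ℝ) ≤ 1 / 2 * (Nat.card {j' : Fin N // dist (y j') (y j) ≤ R₉} : ℝ) ∧ (∀ j' : Fin N, dist (y j') (y j) ≤ R₉ → ¬ Gy (1 / 8) N (y) j' → ¬ (let d : ℝ := sInf ((fun z => dist z (y j')) '' (Set.range (y) \ {(y j')})); ∀ k : Fin N, y k ≠ y j' → dist (y k) (y j') < 27 / 20 * d → 5 ≤ Nat.card {m : Fin N // y m ≠ y j' ∧ dist (y m) (y j') < 27 / 20 * d ∧ y m ≠ y k ∧ dist (y m) (y k) < 27 / 20 * d})))); let ApprS : Set (EuclideanSpace ℝ (Fin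 3)) → ℝ → ℝ → ℝ → Prop := fun S R₇ R₈ R₉ => ∀ q : EuclideanSpace ℝ (Fin 3), q ∈ S → ∀ R ε : ℝ, 0 < ε → ∃ (N : ℕ) (y : Fin N → EuclideanSpace ℝ (Fin 3)) (i : Fin N), TexBall N y i R R₇ R₈ R₉ ∧ (∀ p : EuclideanSpace ℝ (Fin 3), p ∈ S → dist p q ≤ R → ∃ k : Fin N, dist (y k - y i) (p - q) ≤ ε) ∧ (∀ k : Fin N, dist (y k) (y i) ≤ R → ∃ p : EuclideanSpace ℝ (Fin 3), p ∈ S ∧ dist (y k - y i) (p - q) ≤ ε); let NashS : Set (EuclideanSpace ℝ (Fin 3)) → Prop := fun S => ∀ p : EuclideanSpace ℝ (Fin 3), p ∈ S → ∀ y : EuclideanSpace ℝ (Fin 3), (∀ q : EuclideanSpace ℝ (Fin 3), q ∈ S → q ≠ p → y ≠ q) → ∑' q : {q : EuclideanSpace ℝ (Fin 3) // q ∈ S ∧ q ≠ p}, Literature.MathematicalPhysics.StatisticalMechanics.lennardJones (dist p (q : EuclideanSpace ℝ (Fin 3))) ≤ ∑' q : {q : EuclideanSpace ℝ (Fin 3)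 // q ∈ S ∧ q ≠ p}, Literature.MathematicalPhysics.StatisticalMechanics.lennardJones (dist y (q : EuclideanSpace ℝ (Fin 3))); let GyS : ℝ → Set (EuclideanSpace ℝ (Fin 3)) → EuclideanSpace ℝ (Fin 3) → Prop := fun η S x => let d : ℝ := sInf ((fun z => dist z x) '' (S \ {x})); let T : Set (EuclideanSpace ℝ (Fin 3)) := {z : EuclideanSpace ℝ (Fin 3) | z ∈ S ∧ z ≠ x ∧ dist z x < 13 / 10 * d}; ∃ A : EuclideanSpace ℝ (Fin 3) →ₗᵢ[ℝ] EuclideanSpace ℝ (Fin 3), (∃ e : ↥T ≃ ↥Literature.Geometry.DiscreteGeometry.fccKissingPattern, ∀ t : ↥T, dist (d⁻¹ • ((t : EuclideanSpace ℝ (Fin 3)) - x)) (A ((e t : ↥Literature.Geometry.DiscreteGeometry.fccKissingPattern) : EuclideanSpace ℝ (Fin 3))) ≤ η) ∨ (∃ e : ↥T ≃ ↥Literature.Geometry.DiscreteGeometry.hcpKissingPattern, ∀ t : ↥T, dist (d⁻¹ • ((t : EuclideanSpace ℝ (Fin 3)) - x)) (A ((e t : ↥Literature.Geometry.DiscreteGeometry.hcpKissingPattern)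 : EuclideanSpace ℝ (Fin 3))) ≤ η); let Band : (EuclideanSpace ℝ (Fin 3) →L[ℝ] EuclideanSpace ℝ (Fin 3)) → Prop := fun A => ∀ v : EuclideanSpace ℝ (Fin 3), 9 / 10 * ‖v‖ ≤ ‖A v‖ ∧ ‖A v‖ ≤ 11 / 10 * ‖v‖; let Tmpl : (EuclideanSpace ℝ (Fin 3) →L[ℝ] EuclideanSpace ℝ (Fin 3)) → (ℤ → ℤ) → EuclideanSpace ℝ (Fin 3) → EuclideanSpace ℝ (Fin 3) → Set (EuclideanSpace ℝ (Fin 3)) := fun A s c x => (fun b : EuclideanSpace ℝ (Fin 3) => x + A (b - c)) '' Literature.MathematicalPhysics.StatisticalMechanics.barlowStacking 1 (Real.sqrt (2 / 3)) s; let CollarS : Set (EuclideanSpace ℝ (Fin 3)) → EuclideanSpace ℝ (Fin 3) → Prop := fun S x => ∃ (A : EuclideanSpace ℝ (Fin 3) →L[ℝ] EuclideanSpace ℝ (Fin 3)) (s : ℤ → ℤ) (c : EuclideanSpace ℝ (Fin 3)), Literature.MathematicalPhysics.StatisticalMechanics.IsHaggSeq s ∧ Band A ∧ (∀ y ∈ S,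 2 ≤ dist y x → dist y x ≤ 6 → ∃ p ∈ Tmpl A s c x, dist y p ≤ 1 / 50) ∧ (∀ p ∈ Tmpl A s c x, 2 ≤ dist p x → dist p x ≤ 6 → ∃ y ∈ S, dist y p ≤ 1 / 50); let GrainS : Set (EuclideanSpace ℝ (Fin 3)) → EuclideanSpace ℝ (Fin 3) → Prop := fun S x => ∃ (A : EuclideanSpace ℝ (Fin 3) →L[ℝ] EuclideanSpace ℝ (Fin 3)) (s : ℤ → ℤ) (c : EuclideanSpace ℝ (Fin 3)), Literature.MathematicalPhysics.StatisticalMechanics.IsHaggSeq s ∧ Band A ∧ (Set.ncard {y : EuclideanSpace ℝ (Fin 3) | y ∈ S ∧ dist y x ≤ 1024 ∧ ∀ p ∈ Tmpl A s c x, 1 / 100 < dist y p} : ℝ) + (Set.ncard {p : EuclideanSpace ℝ (Fin 3) | p ∈ Tmpl A s c x ∧ dist p x ≤ 1024 ∧ ∀ y ∈ S, 1 / 100 < dist y p} : ℝ) ≤ 1 / 1000 * (Set.ncard {y : EuclideanSpace ℝ (Fin 3) | y ∈ S ∧ dist y x ≤ 1024} : ℝ); let UR : Set (EuclideanSpace ℝ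 (Fin 3)) → Prop := fun S => ∀ R ε : ℝ, 0 < ε → ∃ G : ℝ, ∀ w ∈ S, ∃ g ∈ S, dist g w ≤ G ∧ (∀ s ∈ S, dist s (0 : EuclideanSpace ℝ (Fin 3)) ≤ R → ∃ a ∈ S, dist (a - g) s ≤ ε) ∧ (∀ a ∈ S, dist (a - g) (0 : EuclideanSpace ℝ (Fin 3)) ≤ R → ∃ s ∈ S, dist (a - g) s ≤ ε); (0 : EuclideanSpace ℝ (Fin 3)) ∈ S → (∀ p ∈ S, ∀ q ∈ S, p ≠ q → δ ≤ dist p q) → (∃ R₇ R₈ R₉ : ℝ, ApprS S R₇ R₈ R₉) → NashS S → (¬ ∃ (Q : Literature.MathematicalPhysics.StatisticalMechanics.PeriodicConfiguration 3) (t : EuclideanSpace ℝ (Fin 3)), S = (fun s => s + t) '' Q.points) → (¬ ∃ x : EuclideanSpace ℝ (Fin 3), GrainS S x) → (¬ ∃ x : EuclideanSpace ℝ (Fin 3), x ∈ S ∧ ¬ GyS (1 / 8) S x ∧ CollarS S x) → UR S → ¬ Literature.MathematicalPhysics.StatisticalMechanics.IsMuGSC Literature.MathematicalPhysics.StatisticalMechanics.lennardJones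 (⨅ Q : Literature.MathematicalPhysics.StatisticalMechanics.PeriodicConfiguration 3, Q.energyPerParticle Literature.MathematicalPhysics.StatisticalMechanics.lennardJones) S of `stub_repetitiveRigidity`** (residual `RepetitiveNetworkLawGap` of the child route
RepetitiveNetworkReduction, exact binder shape, `δ ≥ 4`): a rooted `δ`-separated (δ ≥ 4) textured Nash non-periodic
grain-free core-free uniformly recurrent point set is not an `e⋆`-μGSC of `V_LJ`. [folklore] -/
theorem repetitiveRigidity_rung_dilute :
    ∀ δ : ℝ, 4 ≤ δ → ∀ S : Set (EuclideanSpace ℝ (Fin 3)), let Gy : ℝ → (N : ℕ) → (Fin N → EuclideanSpace ℝ (Fin 3)) → Fin N → Prop := fun η N y j => let d : ℝ := sInf ((fun z => dist z (y (j : Fin N))) '' (Set.range (y) \ {(y (j : Fin N))})); let T : Set (EuclideanSpace ℝ (Fin 3)) := {z : EuclideanSpace ℝ (Fin 3) | z ∈ Set.range (y) ∧ z ≠ (y (j : Fin N)) ∧ dist z (y (j : Fin N)) < 13 / 10 * d}; ∃ A : EuclideanSpace ℝ (Fin 3) →ₗᵢ[ℝ] EuclideanSpace ℝ (Fin 3),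 (∃ e : ↥T ≃ ↥Literature.Geometry.DiscreteGeometry.fccKissingPattern, ∀ t : ↥T, dist (d⁻¹ • ((t : EuclideanSpace ℝ (Fin 3)) - (y (j : Fin N)))) (A ((e t : ↥Literature.Geometry.DiscreteGeometry.fccKissingPattern) : EuclideanSpace ℝ (Fin 3))) ≤ η) ∨ (∃ e : ↥T ≃ ↥Literature.Geometry.DiscreteGeometry.hcpKissingPattern, ∀ t : ↥T, dist (d⁻¹ • ((t : EuclideanSpace ℝ (Fin 3)) - (y (j : Fin N)))) (A ((e t : ↥Literature.Geometry.DiscreteGeometry.hcpKissingPattern) : EuclideanSpace ℝ (Fin 3))) ≤ η); let TexBall : (N : ℕ) → (Fin N → EuclideanSpace ℝ (Fin 3)) → Fin N → ℝ → ℝ → ℝ → ℝ → Prop := fun N y i R R₇ R₈ R₉ => (∀ a b : Fin N, a ≠ b → (7 : ℝ) / 10 ≤ dist (y a) (y b)) ∧ (∀ j : Fin N, dist (y j) (y i) ≤ R → ¬ Gy (1 / 20) N (y) j) ∧ (∀ j : Fin N, dist (y j) (y i) ≤ R → ¬ ((∀ j' : Fin N, dist (y j') (y j) ≤ R₇ →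 ¬ Gy (1 / 20) N (y) j') ∧ (∀ z : EuclideanSpace ℝ (Fin 3), dist z (y j) ≤ R₇ → ∃ k : Fin N, dist z (y k) ≤ 1) ∧ (∀ j' : Fin N, dist (y j') (y j) ≤ R₇ → (let d : ℝ := sInf ((fun z => dist z (y j')) '' (Set.range (y) \ {(y j')})); ∀ k : Fin N, y k ≠ y j' → dist (y k) (y j') < 27 / 20 * d → 5 ≤ Nat.card {m : Fin N // y m ≠ y j' ∧ dist (y m) (y j') < 27 / 20 * d ∧ y m ≠ y k ∧ dist (y m) (y k) < 27 / 20 * d})))) ∧ (∀ j : Fin N, dist (y j) (y i) ≤ R → ∃ k : Fin N, dist (y k) (y j) ≤ R₈ ∧ Gy (1 / 8) N (y) k) ∧ (∀ j : Fin N, dist (y j) (y i) ≤ R → ¬ ((∀ j' : Fin N, dist (y j') (y j) ≤ R₉ → ¬ Gy (1 / 20) N (y) j') ∧ (Nat.card {j' : Fin N // dist (y j') (y j) ≤ R₉ ∧ ¬ Gy (1 / 8) N (y) j'} : ℝ) ≤ 1 / 2 * (Nat.card {j' : Fin N // dist (y j') (y j) ≤ R₉} : ℝ) ∧ (∀ j'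 : Fin N, dist (y j') (y j) ≤ R₉ → ¬ Gy (1 / 8) N (y) j' → ¬ (let d : ℝ := sInf ((fun z => dist z (y j')) '' (Set.range (y) \ {(y j')})); ∀ k : Fin N, y k ≠ y j' → dist (y k) (y j') < 27 / 20 * d → 5 ≤ Nat.card {m : Fin N // y m ≠ y j' ∧ dist (y m) (y j') < 27 / 20 * d ∧ y m ≠ y k ∧ dist (y m) (y k) < 27 / 20 * d})))); let ApprS : Set (EuclideanSpace ℝ (Fin 3)) → ℝ → ℝ → ℝ → Prop := fun S R₇ R₈ R₉ => ∀ q : EuclideanSpace ℝ (Fin 3), q ∈ S → ∀ R ε : ℝ, 0 < ε → ∃ (N : ℕ) (y : Fin N → EuclideanSpace ℝ (Fin 3)) (i : Fin N), TexBall N y i R R₇ R₈ R₉ ∧ (∀ p : EuclideanSpace ℝ (Fin 3), p ∈ S → dist p q ≤ R → ∃ k : Fin N, dist (y k - y i) (p - q) ≤ ε) ∧ (∀ k : Fin N, dist (y k) (y i) ≤ R → ∃ p : EuclideanSpace ℝ (Fin 3), p ∈ S ∧ dist (y k - y i) (p - q) ≤ ε); let NashS : Set (EuclideanSpace ℝ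 (Fin 3)) → Prop := fun S => ∀ p : EuclideanSpace ℝ (Fin 3), p ∈ S → ∀ y : EuclideanSpace ℝ (Fin 3), (∀ q : EuclideanSpace ℝ (Fin 3), q ∈ S → q ≠ p → y ≠ q) → ∑' q : {q : EuclideanSpace ℝ (Fin 3) // q ∈ S ∧ q ≠ p}, Literature.MathematicalPhysics.StatisticalMechanics.lennardJones (dist p (q : EuclideanSpace ℝ (Fin 3))) ≤ ∑' q : {q : EuclideanSpace ℝ (Fin 3) // q ∈ S ∧ q ≠ p}, Literature.MathematicalPhysics.StatisticalMechanics.lennardJones (dist y (q : EuclideanSpace ℝ (Fin 3))); let GyS : ℝ → Set (EuclideanSpace ℝ (Fin 3)) → EuclideanSpace ℝ (Fin 3) → Prop := fun η S x => let d : ℝ := sInf ((fun z => dist z x) '' (S \ {x})); let T : Set (EuclideanSpace ℝ (Fin 3)) := {z : EuclideanSpace ℝ (Fin 3) | z ∈ S ∧ z ≠ x ∧ dist z x < 13 / 10 * d}; ∃ A : EuclideanSpace ℝ (Fin 3) →ₗᵢ[ℝ] EuclideanSpace ℝ (Fin 3), (∃ e : ↥T ≃ ↥Literature.Geometry.DiscreteGeometry.fccKissingPattern,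 ∀ t : ↥T, dist (d⁻¹ • ((t : EuclideanSpace ℝ (Fin 3)) - x)) (A ((e t : ↥Literature.Geometry.DiscreteGeometry.fccKissingPattern) : EuclideanSpace ℝ (Fin 3))) ≤ η) ∨ (∃ e : ↥T ≃ ↥Literature.Geometry.DiscreteGeometry.hcpKissingPattern, ∀ t : ↥T, dist (d⁻¹ • ((t : EuclideanSpace ℝ (Fin 3)) - x)) (A ((e t : ↥Literature.Geometry.DiscreteGeometry.hcpKissingPattern) : EuclideanSpace ℝ (Fin 3))) ≤ η); let Band : (EuclideanSpace ℝ (Fin 3) →L[ℝ] EuclideanSpace ℝ (Fin 3)) → Prop := fun A => ∀ v : EuclideanSpace ℝ (Fin 3), 9 / 10 * ‖v‖ ≤ ‖A v‖ ∧ ‖A v‖ ≤ 11 / 10 * ‖v‖; let Tmpl : (EuclideanSpace ℝ (Fin 3) →L[ℝ] EuclideanSpace ℝ (Fin 3)) → (ℤ → ℤ) → EuclideanSpace ℝ (Fin 3) → EuclideanSpace ℝ (Fin 3) → Set (EuclideanSpace ℝ (Fin 3)) := fun A s c x => (fun b : EuclideanSpace ℝ (Fin 3) => x + A (b - c)) ''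 Literature.MathematicalPhysics.StatisticalMechanics.barlowStacking 1 (Real.sqrt (2 / 3)) s; let CollarS : Set (EuclideanSpace ℝ (Fin 3)) → EuclideanSpace ℝ (Fin 3) → Prop := fun S x => ∃ (A : EuclideanSpace ℝ (Fin 3) →L[ℝ] EuclideanSpace ℝ (Fin 3)) (s : ℤ → ℤ) (c : EuclideanSpace ℝ (Fin 3)), Literature.MathematicalPhysics.StatisticalMechanics.IsHaggSeq s ∧ Band A ∧ (∀ y ∈ S, 2 ≤ dist y x → dist y x ≤ 6 → ∃ p ∈ Tmpl A s c x, dist y p ≤ 1 / 50) ∧ (∀ p ∈ Tmpl A s c x, 2 ≤ dist p x → dist p x ≤ 6 → ∃ y ∈ S, dist y p ≤ 1 / 50); let GrainS : Set (EuclideanSpace ℝ (Fin 3)) → EuclideanSpace ℝ (Fin 3) → Prop := fun S x => ∃ (A : EuclideanSpace ℝ (Fin 3) →L[ℝ] EuclideanSpace ℝ (Fin 3)) (s : ℤ → ℤ) (c : EuclideanSpace ℝ (Fin 3)), Literature.MathematicalPhysics.StatisticalMechanics.IsHaggSeq s ∧ Band A ∧ (Set.ncard {y : EuclideanSpace ℝ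 (Fin 3) | y ∈ S ∧ dist y x ≤ 1024 ∧ ∀ p ∈ Tmpl A s c x, 1 / 100 < dist y p} : ℝ) + (Set.ncard {p : EuclideanSpace ℝ (Fin 3) | p ∈ Tmpl A s c x ∧ dist p x ≤ 1024 ∧ ∀ y ∈ S, 1 / 100 < dist y p} : ℝ) ≤ 1 / 1000 * (Set.ncard {y : EuclideanSpace ℝ (Fin 3) | y ∈ S ∧ dist y x ≤ 1024} : ℝ); let UR : Set (EuclideanSpace ℝ (Fin 3)) → Prop := fun S => ∀ R ε : ℝ, 0 < ε → ∃ G : ℝ, ∀ w ∈ S, ∃ g ∈ S, dist g w ≤ G ∧ (∀ s ∈ S, dist s (0 : EuclideanSpace ℝ (Fin 3)) ≤ R → ∃ a ∈ S, dist (a - g) s ≤ ε) ∧ (∀ a ∈ S, dist (a - g) (0 : EuclideanSpace ℝ (Fin 3)) ≤ R → ∃ s ∈ S, dist (a - g) s ≤ ε); (0 : EuclideanSpace ℝ (Fin 3)) ∈ S → (∀ p ∈ S, ∀ q ∈ S, p ≠ q → δ ≤ dist p q) → (∃ R₇ R₈ R₉ : ℝ, ApprS S R₇ R₈ R₉) →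 NashS S → (¬ ∃ (Q : Literature.MathematicalPhysics.StatisticalMechanics.PeriodicConfiguration 3) (t : EuclideanSpace ℝ (Fin 3)), S = (fun s => s + t) '' Q.points) → (¬ ∃ x : EuclideanSpace ℝ (Fin 3), GrainS S x) → (¬ ∃ x : EuclideanSpace ℝ (Fin 3), x ∈ S ∧ ¬ GyS (1 / 8) S x ∧ CollarS S x) → UR S → ¬ Literature.MathematicalPhysics.StatisticalMechanics.IsMuGSC Literature.MathematicalPhysics.StatisticalMechanics.lennardJones (⨅ Q : Literature.MathematicalPhysics.StatisticalMechanics.PeriodicConfiguration 3, Q.energyPerParticle Literature.MathematicalPhysics.StatisticalMechanics.lennardJones) S := by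
  intro δ hδ S
  dsimp only
  intro h0 hsep _ _ _ _ _ _
  exact not_isMuGSC_eStar_of_four_le hδ h0 hsep

end Summit.AtomisticToContinuum.Crystallization.Theorems.RepetitiveNetworkReductionDiluteRung
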